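import Summits.QuantumAdvantage.QuantumAdvantage.Theorems.SosSandwichPseudoBoundedAAClassicalCornerL2OSSSNoGoBalancedRec
import HarnessLib

/-!
# Crux `PseudoBoundedAA` (stmt-QuantumAdvantage-15237, route SosSandwich) — the `L²`-OSSS question on the classical
# corner: NO-GO for the UN-normalised per-tree route with a BALANCED tree, part 3/3 — the no-go theorems

Support file (`--supports stmt-QuantumAdvantage-15237`), sequel of `…ClassicalCornerL2OSSSNoGoBalancedStep.lean` (gluing
step) and `…ClassicalCornerL2OSSSNoGoBalancedRec.lean` (`exists_recAddress`: the depth-`(k+1)` recursive binary address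
tree on any block of `≥ 2^{k+1} − 1` coordinates, mean `½`, `Cov_un = 4^N(k+1)/4`, `Σⱼ WⱼSⱼ ≤ 3(k+1)4^N`).  Conclusions,
in the un-normalised cube sums of `osss_sens` (`Wⱼ = #{x : j ∈ t.queries x}`, `Sⱼ = Σₓ(g(x^{j→1}) − g(x^{j→0}))²`):

* **`recAddress_family`** — on `N ≥ 2^{k+1} − 1` bits: a BALANCED depth-`(k+1)` tree and `g` with
  `Cov[F,g] = (k+1)/4` and `Σⱼ δⱼ(t) Infⱼ[g] ≤ 3(k+1)` (un-normalised: `Cov_un = 4^N(k+1)/4`, `Σⱼ Wⱼ Sⱼ ≤ 3(k+1)4^N`);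
* **`exists_bilinear_osss_violation`** — `∀ A, ∃ N t g` (balanced `F`) with `A·4^N·Σⱼ WⱼSⱼ < Cov_un²` AND
  `A·(2^N Σ F² − (Σ F)²)·Σⱼ WⱼSⱼ < Cov_un²`, i.e. `Cov[F,g]² > A·Σⱼ δⱼ(t)Infⱼ[g]` and `> A·Var[F]·Σⱼ δⱼ(t)Infⱼ[g]`;
* **`not_exists_bilinear_osss`** — there is NO constant `A` with `Cov[F,g]² ≤ A·Σⱼ δⱼ(t)·Infⱼ[g]` for all trees `t`
  (output `F`) and real `g`.  By convex duality `sup_g Cov[F,g]²/Σⱼδⱼ(t)Infⱼ[g] = ¼·Σ_{S≠∅} F̂(S)²/δ_t(S)`, so this is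
  the statement that the `F̂²`-weighted HARMONIC mean of the query weights `δ_t(S) = Σ_{j∈S}δⱼ(t)` is not bounded below in
  terms of `Var F` (here `Var F = ¼` throughout), in contrast with OSSS (arithmetic mean `≥ Var`-scale).

Consequence for the census's question: an absolute-constant `L²`-OSSS law `16 Var[p]² ≤ C₀ Σⱼ δ̄ⱼ Infⱼ[p]` for mixtures
`p = Σ_k w_k[t_k accepts]`, if true, cannot be obtained from ANY per-tree inequality `Cov[F_k,p]² ≤ A·(…)·Σⱼδⱼ(t_k)Infⱼ[p]`
with `(…) ∈ {1, Var F_k}` and Cauchy–Schwarz over `k` (the route giving `C₀ = Ī` in `…SensitivityOSSS.lean`); a proof must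
use that `p` is the mixture of the same trees.  (The dual witness of the recursive address tree is dominated by the
UNSCALED sum of its `2^k` data-bit dictators; as a `[0,1]`-mixture it must be scaled by `2^{−k}`, which makes it harmless —
hands' evidence L2OSSS-NOGO-15237.md, with numerics `Φ(T_h) = Σ_S F̂²/δ = 0.25, 0.333, 0.419, 0.506` for `h ≤ 4`.)

Honest label: calibration (no-go for a proof strategy) in the classical corner of an open conjecture; nothing is closed.
Sources: O'Donnell–Saks–Schramm–Servedio, FOCS 2005, Thm 3.2; R. O'Donnell, *Analysis of Boolean Functions* (2014) §8.6.
-/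

set_option linter.dupNamespace false

noncomputable section

namespace Summit.QuantumAdvantage.QuantumAdvantage.Theorems.SosSandwich

open Finset Function
open Literature.Computability.Complexity

namespace ClassicalCornerL2OSSSNoGoBalanced

variable {N : ℕ}

/-- **The recursive binary address family.** On `N ≥ 2^{k+1} − 1` bits there are a decision tree `t` of depth `k+1` with
BALANCED `0/1` output `F` (`Σ F = 2^N/2`, so `2^N Σ F² − (Σ F)² = 4^N/4`, i.e. `Var F = ¼`) and a real `g` with
`2^N Σ F g − Σ F Σ g = 4^N (k+1)/4` (`Cov[F,g] = (k+1)/4`) and `Σⱼ Wⱼ Sⱼ ≤ 3(k+1)·4^N` (`Σⱼ δⱼ(t) Infⱼ[g] ≤ 3(k+1)`).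
[folklore] -/
theorem recAddress_family (k : ℕ) (hN : 2 ^ (k + 1) - 1 ≤ N) :
    ∃ (t : DecisionTree N) (g F : (Fin N → Bool) → ℝ), t.depth = k + 1 ∧
      (∀ x, F x = if t.eval x = true then (1 : ℝ) else 0) ∧
      ∑ x, F x = (2 : ℝ) ^ N / 2 ∧
      (2 : ℝ) ^ N * (∑ x, F x ^ 2) - (∑ x, F x) ^ 2 = (4 : ℝ) ^ N / 4 ∧
      (2 : ℝ) ^ N * (∑ x, F x * g x) - (∑ x, F x) * (∑ x, g x) = (4 : ℝ) ^ N * ((k : ℝ) + 1) / 4 ∧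
      (∑ j, ((Finset.univ.filter fun x : Fin N → Bool => j ∈ t.queries x).card : ℝ) *
          ∑ x, (g (update x j true) - g (update x j false)) ^ 2) ≤ 3 * ((k : ℝ) + 1) * (4 : ℝ) ^ N := by
  classical
  have hcard : 2 ^ (k + 1) - 1 ≤ (Finset.univ : Finset (Fin N)).card := by
    rwa [Finset.card_univ, Fintype.card_fin]
  obtain ⟨t, g, F, hd, hF, -, -, hmean, hcov, -, -, hS⟩ := exists_recAddress k (Finset.univ : Finset (Fin N)) hcard
  refine ⟨t, g, F, hd, hF, hmean, ?_, hcov, hS⟩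
  have hsq : ∀ x, F x ^ 2 = F x := by intro x; rw [hF x]; split_ifs <;> norm_num
  rw [Finset.sum_congr rfl fun x _ => hsq x, hmean, show (4 : ℝ) ^ N = (2 : ℝ) ^ N * (2 : ℝ) ^ N by
    rw [← mul_pow]; norm_num]
  ring

/-- The arithmetic of the no-go: `WS ≤ 3·kk·P`, `V ≤ P`, `48A < kk` give `A·V·WS < (P·kk/4)²`. [folklore] -/
theorem noGo_arith (A P V WS kk : ℝ) (hP : 0 < P) (hV0 : 0 < V) (hVP : V ≤ P) (hWS0 : 0 ≤ WS) (hkk : 0 < kk)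
    (hS : WS ≤ 3 * kk * P) (hA : 48 * A < kk) : A * (V * WS) < (P * kk / 4) ^ 2 := by
  by_cases hA0 : A ≤ 0
  · have h1 : A * (V * WS) ≤ 0 := mul_nonpos_of_nonpos_of_nonneg hA0 (mul_nonneg hV0.le hWS0)
    have h2 : 0 < (P * kk / 4) ^ 2 := by positivity
    linarith
  · push Not at hA0
    have h1 : A * (V * WS) ≤ A * (P * (3 * kk * P)) :=
      mul_le_mul_of_nonneg_left (mul_le_mul hVP hS hWS0 hP.le) hA0.le
    have hP2 : 0 < P * P := mul_pos hP hP
    have h3 : 3 * A * kk < kk * kk / 16 := by nlinarith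
    have h4 : A * (P * (3 * kk * P)) < (P * kk / 4) ^ 2 := by
      rw [show A * (P * (3 * kk * P)) = (3 * A * kk) * (P * P) by ring,
        show (P * kk / 4) ^ 2 = (kk * kk / 16) * (P * P) by ring]
      exact mul_lt_mul_of_pos_right h3 hP2
    linarith

/-- **No bilinear OSSS inequality with an absolute constant — normalised or not, even for balanced trees.**  For every
real `A` there are `N`, a decision tree `t` on `N` bits with BALANCED `0/1` output `F` and a real `g` with BOTH
`A · 4^N · Σⱼ WⱼSⱼ < (2^N Σ F g − Σ F Σ g)²` (i.e. `Cov[F,g]² > A · Σⱼ δⱼ(t)·Infⱼ[g]`) and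
`A · (2^N Σ F² − (Σ F)²) · Σⱼ WⱼSⱼ < (2^N Σ F g − Σ F Σ g)²` (i.e. `Cov[F,g]² > A · Var[F] · Σⱼ δⱼ(t)·Infⱼ[g]`):
the recursive address tree of depth `k+1 > 48·A`. [folklore] -/
theorem exists_bilinear_osss_violation (A : ℝ) :
    ∃ (N : ℕ) (t : DecisionTree N) (g F : (Fin N → Bool) → ℝ),
      (∀ x, F x = if t.eval x = true then (1 : ℝ) else 0) ∧
      ∑ x, F x = (2 : ℝ) ^ N / 2 ∧
      A * ((4 : ℝ) ^ N * ∑ j, ((Finset.univ.filter fun x : Fin N → Bool => j ∈ t.queries x).card : ℝ) *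
          ∑ x, (g (update x j true) - g (update x j false)) ^ 2) <
        ((2 : ℝ) ^ N * (∑ x, F x * g x) - (∑ x, F x) * (∑ x, g x)) ^ 2 ∧
      A * ((((2 : ℝ) ^ N * (∑ x, F x ^ 2) - (∑ x, F x) ^ 2)) *
          ∑ j, ((Finset.univ.filter fun x : Fin N → Bool => j ∈ t.queries x).card : ℝ) *
            ∑ x, (g (update x j true) - g (update x j false)) ^ 2) <
        ((2 : ℝ) ^ N * (∑ x, F x * g x) - (∑ x, F x) * (∑ x, g x)) ^ 2 := by
  classical
  obtain ⟨t, g, F, -, hF, hmean, hvar, hcov, hS⟩ :=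
    recAddress_family (N := 2 ^ (⌈48 * A⌉₊ + 1) - 1) ⌈48 * A⌉₊ le_rfl
  refine ⟨2 ^ (⌈48 * A⌉₊ + 1) - 1, t, g, F, hF, hmean, ?_, ?_⟩
  · have h4 : (0 : ℝ) < (4 : ℝ) ^ (2 ^ (⌈48 * A⌉₊ + 1) - 1) := by positivity
    have hkk : (0 : ℝ) < (⌈48 * A⌉₊ : ℝ) + 1 := by positivity
    have hA : 48 * A < (⌈48 * A⌉₊ : ℝ) + 1 := by linarith [Nat.le_ceil (48 * A)]
    have hWS0 : 0 ≤ ∑ j, ((Finset.univ.filter fun x : Fin (2 ^ (⌈48 * A⌉₊ + 1) - 1) → Bool =>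
        j ∈ t.queries x).card : ℝ) * ∑ x, (g (update x j true) - g (update x j false)) ^ 2 :=
      Finset.sum_nonneg fun j _ => mul_nonneg (Nat.cast_nonneg _) (Finset.sum_nonneg fun x _ => sq_nonneg _)
    rw [hcov]
    exact noGo_arith A _ _ _ _ h4 h4 le_rfl hWS0 hkk hS hA
  · have h4 : (0 : ℝ) < (4 : ℝ) ^ (2 ^ (⌈48 * A⌉₊ + 1) - 1) := by positivity
    have hkk : (0 : ℝ) < (⌈48 * A⌉₊ : ℝ) + 1 := by positivity
    have hA : 48 * A < (⌈48 * A⌉₊ : ℝ) + 1 := by linarith [Nat.le_ceil (48 * A)]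
    have hWS0 : 0 ≤ ∑ j, ((Finset.univ.filter fun x : Fin (2 ^ (⌈48 * A⌉₊ + 1) - 1) → Bool =>
        j ∈ t.queries x).card : ℝ) * ∑ x, (g (update x j true) - g (update x j false)) ^ 2 :=
      Finset.sum_nonneg fun j _ => mul_nonneg (Nat.cast_nonneg _) (Finset.sum_nonneg fun x _ => sq_nonneg _)
    rw [hcov, hvar]
    exact noGo_arith A _ _ _ _ h4 (by positivity) (by linarith) hWS0 hkk hS hA

/-- **No-go, negation form.** There is NO constant `A` such that `(2^N Σ F g − Σ F Σ g)² ≤ A·4^N·Σⱼ #{x : j ∈ t.queries x}·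
Σₓ(g(x^{j→1}) − g(x^{j→0}))²` — i.e. `Cov[F,g]² ≤ A·Σⱼ δⱼ(t)·Infⱼ[g]` — for all decision trees `t` (with `0/1` output `F`)
and all real `g`; a fortiori none with the extra factor `Var[F] ≤ ¼`.  Hence the census's `L²`-OSSS law for mixtures,
if true with an absolute constant, is not a consequence of any per-tree bilinear bound averaged by Cauchy–Schwarz.
[folklore] -/
theorem not_exists_bilinear_osss :
    ¬ ∃ A : ℝ, ∀ (N : ℕ) (t : DecisionTree N) (g F : (Fin N → Bool) → ℝ),
      (∀ x, F x = if t.eval x = true then (1 : ℝ) else 0) →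
      ((2 : ℝ) ^ N * (∑ x, F x * g x) - (∑ x, F x) * (∑ x, g x)) ^ 2 ≤
        A * ((4 : ℝ) ^ N * ∑ j, ((Finset.univ.filter fun x : Fin N → Bool => j ∈ t.queries x).card : ℝ) *
          ∑ x, (g (update x j true) - g (update x j false)) ^ 2) := by
  rintro ⟨A, hA⟩
  obtain ⟨N, t, g, F, hF, -, hlt, -⟩ := exists_bilinear_osss_violation A
  exact absurd (hA N t g F hF) (not_le.mpr hlt)

end ClassicalCornerL2OSSSNoGoBalanced

end Summit.QuantumAdvantage.QuantumAdvantage.Theorems.SosSandwich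

end
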